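import Summits.ABC.ABC.Theses.IneffectiveSubspace
import Summits.ABC.ABC.Theorems.IneffectiveSubspaceAbcGivesUniformSadic
import Summits.ABC.ABC.Theorems.IneffectiveSubspaceUniformSadicGivesTowerFour

/-!
# `UniformSadicTowerFour` (stmt-ABC-14937): which hypotheses are load-bearing

Negative-side support lemmas of the standing disprover (cycle 1, refuter-cdisprove-stmt-ABC-14937-0,
2026-08-16) for crux #2 of route `IneffectiveSubspace`.  The crux: for every `K`, `ε > 0` there is
`C(K, ε)` with `c < C·((∏_{p∈S} p)·{M}^S)^(1+ε)` for every set `S` of at most `K` primes and every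
positive coprime level-4 tower point (`c = ∏ zᵢ^(i+1)`, `M = ∏ xᵢyᵢzᵢ`, `{M}^S` the `S`-free part of
`M`; "the bracket" is `(∏_{p∈S} p)·{M}^S`).  It cannot be refuted short of refuting `ABC`
(`abcGivesUniformSadic_proof`); this file records, with every statement inlined (no auxiliary `def`),
what dropping each hypothesis does:

* `uniformSadicTowerFour_false_without_coprime` — coprimality IS load-bearing: `2^n + 2^n = 2^{n+1}`
  with `S = {2}` has bracket `2` (`bracket_two_pow`), so no `C(1, 1)` exists.  (For the sibling crux
  `TowerFourSubLiouville` dropping coprimality only moves the exponent floor to `4/3`,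
  `TowerFourSubLiouville.Negative.NoCoprimeSharp`; here the `S`-discount swallows the whole point.)
* `uniformSadicTowerFour_false_without_prime` — primality of the members of `S` is load-bearing, but only
  through `0 ∈ S`: `S = {0}` makes the bracket `0`.
* `uniformSadicTowerFour_false_without_eq` — the equation is load-bearing (`z = (1,1,1,m)`, `S = ∅`).
* `uniformSadicTowerFour_iff_without_pos` — positivity is NOT load-bearing: a vanishing coordinate forces
  `c ≤ 1` (coprimality + the equation) while the bracket of `M = 0` is `∏_{p∈S} p ≥ 1`, so `max C 2`
  serves the degenerate points.
* The budget `S.card ≤ K` is load-bearing exactly to the extent `ABC` is open: with `C` free of `K` the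
  statement is `ABC` (landed stub `IneffectiveSubspaceUniformSadicTowerFourStubUniformInKIffAbc`).

Uses only Mathlib and the landed `AbcGivesUniformSadic.sadic_pos` / `UniformSadicGivesTowerFour.bracket_empty`.
-/

-- `Summit.<Summit>.<Problem>` is the mandated summit-side namespace (CONVENTIONS §2); for the
-- single-conjunct summit `ABC` the two coincide, so the duplicate `ABC.ABC` is deliberate.
set_option linter.dupNamespace false

namespace Summit.ABC.ABC.Theorems.UniformSadicTowerFour.Negative

open scoped BigOperators
open Summit.ABC.ABC.Theses.IneffectiveSubspace
open Summit.ABC.ABC.Theorems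

/-- The bracket of a power of `2` at `S = {2}` is `2`: `{2^k}^{{2}} = 1`. [folklore] -/
theorem bracket_two_pow (k : ℕ) :
    (∏ p ∈ ({2} : Finset ℕ), p) * ∏ p ∈ (2 ^ k).primeFactors \ {2}, p ^ (2 ^ k).factorization p = 2 := by
  have hsub : (2 ^ k).primeFactors \ ({2} : Finset ℕ) = ∅ := by
    rcases Nat.eq_zero_or_pos k with rfl | hk
    · simp
    · rw [Nat.primeFactors_prime_pow hk.ne' Nat.prime_two, Finset.sdiff_self]
  rw [hsub, Finset.prod_empty, Finset.prod_singleton, mul_one]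

/-- **Coprimality is load-bearing.** Without `Nat.Coprime a b` the crux fails (already at `K = 1`,
`ε = 1`): the points `x = y = (2^n,1,1,1)`, `z = (2^{n+1},1,1,1)` (`2^n + 2^n = 2^{n+1}`) with
`S = {2}` have bracket `2·{2^{3n+1}}^{{2}} = 2`, so `2^{n+1} < C·2²` fails for `2^n > 4C`. -/
theorem uniformSadicTowerFour_false_without_coprime :
    ¬ ∀ K : ℕ, ∀ ε : ℝ, 0 < ε → ∃ C : ℝ, 0 < C ∧ ∀ S : Finset ℕ, S.card ≤ K → (∀ p ∈ S, Nat.Prime p) →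
      ∀ x y z : Fin 4 → ℕ, (∀ i, 0 < x i ∧ 0 < y i ∧ 0 < z i) →
      (∏ i, x i ^ (i.val + 1)) + (∏ i, y i ^ (i.val + 1)) = ∏ i, z i ^ (i.val + 1) →
      ((∏ i, z i ^ (i.val + 1) : ℕ) : ℝ) < C * (((∏ p ∈ S, p) *
        ∏ p ∈ (∏ i, x i * y i * z i).primeFactors \ S, p ^ (∏ i, x i * y i * z i).factorization p : ℕ) :
          ℝ) ^ (1 + ε) := by
  intro h
  obtain ⟨C, hC, hK⟩ := h 1 1 one_pos
  obtain ⟨n, hn⟩ := exists_nat_gt (4 * C)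
  have key := hK {2} (by simp) (by simp [Nat.prime_two]) ![2 ^ n, 1, 1, 1] ![2 ^ n, 1, 1, 1]
    ![2 ^ (n + 1), 1, 1, 1] (by intro i; fin_cases i <;> simp) (by simp [Fin.prod_univ_four]; ring)
  have h1 : (∏ i : Fin 4, (![2 ^ (n + 1), 1, 1, 1] : Fin 4 → ℕ) i ^ (i.val + 1)) = 2 ^ (n + 1) := by
    simp [Fin.prod_univ_four]
  have h2 : (∏ i : Fin 4, (![2 ^ n, 1, 1, 1] : Fin 4 → ℕ) i * (![2 ^ n, 1, 1, 1] : Fin 4 → ℕ) i *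
      (![2 ^ (n + 1), 1, 1, 1] : Fin 4 → ℕ) i) = 2 ^ (3 * n + 1) := by
    simp [Fin.prod_univ_four]; ring
  rw [h1, h2, bracket_two_pow, show (1 : ℝ) + 1 = 2 by norm_num, Real.rpow_two] at key
  push_cast at key
  have h2n : (n : ℝ) < (2 : ℝ) ^ n := by exact_mod_cast Nat.lt_two_pow_self
  have : (2 : ℝ) ^ (n + 1) = 2 * 2 ^ n := by ring
  nlinarith

/-- **Primality of `S` is load-bearing, but only through `0 ∈ S`.** Without `∀ p ∈ S, p.Prime` the crux
fails at `K = 1`: `S = {0}` makes `∏_{p∈S} p = 0`, so the bracket is `0` and `2 < C·0^(1+ε) = 0` fails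
for the point `1 + 1 = 2`.  (Composite or unit members of `S` are harmless: they are never prime factors of
`M`, so they only enlarge the factor `∏_{p∈S} p`.) -/
theorem uniformSadicTowerFour_false_without_prime :
    ¬ ∀ K : ℕ, ∀ ε : ℝ, 0 < ε → ∃ C : ℝ, 0 < C ∧ ∀ S : Finset ℕ, S.card ≤ K →
      ∀ x y z : Fin 4 → ℕ, (∀ i, 0 < x i ∧ 0 < y i ∧ 0 < z i) →
      (∏ i, x i ^ (i.val + 1)) + (∏ i, y i ^ (i.val + 1)) = ∏ i, z i ^ (i.val + 1) →
      Nat.Coprime (∏ i, x i ^ (i.val + 1)) (∏ i, y i ^ (i.val + 1)) →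
      ((∏ i, z i ^ (i.val + 1) : ℕ) : ℝ) < C * (((∏ p ∈ S, p) *
        ∏ p ∈ (∏ i, x i * y i * z i).primeFactors \ S, p ^ (∏ i, x i * y i * z i).factorization p : ℕ) :
          ℝ) ^ (1 + ε) := by
  intro h
  obtain ⟨C, hC, hK⟩ := h 1 1 one_pos
  have key := hK {0} (by simp) ![1, 1, 1, 1] ![1, 1, 1, 1] ![2, 1, 1, 1]
    (by intro i; fin_cases i <;> simp) (by simp [Fin.prod_univ_four]) (by simp [Fin.prod_univ_four])
  rw [Finset.prod_singleton, zero_mul, show (1 : ℝ) + 1 = 2 by norm_num, Real.rpow_two] at key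
  simp [Fin.prod_univ_four] at key
  linarith

/-- **The equation is load-bearing.** Without `a + b = c` the crux fails at `K = 0`: `x = y = (1,1,1,1)`,
`z = (1,1,1,m)` has `c = m⁴`, `M = m`, bracket (`S = ∅`) `= m`, and `m⁴ < C·m²` fails for `m > C`. -/
theorem uniformSadicTowerFour_false_without_eq :
    ¬ ∀ K : ℕ, ∀ ε : ℝ, 0 < ε → ∃ C : ℝ, 0 < C ∧ ∀ S : Finset ℕ, S.card ≤ K → (∀ p ∈ S, Nat.Prime p) →
      ∀ x y z : Fin 4 → ℕ, (∀ i, 0 < x i ∧ 0 < y i ∧ 0 < z i) →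
      Nat.Coprime (∏ i, x i ^ (i.val + 1)) (∏ i, y i ^ (i.val + 1)) →
      ((∏ i, z i ^ (i.val + 1) : ℕ) : ℝ) < C * (((∏ p ∈ S, p) *
        ∏ p ∈ (∏ i, x i * y i * z i).primeFactors \ S, p ^ (∏ i, x i * y i * z i).factorization p : ℕ) :
          ℝ) ^ (1 + ε) := by
  intro h
  obtain ⟨C, hC, hK⟩ := h 0 1 one_pos
  obtain ⟨m, hm⟩ := exists_nat_gt C
  have hm0 : 0 < m := by exact_mod_cast hC.trans hm
  have key := hK ∅ (by simp) (by simp) ![1, 1, 1, 1] ![1, 1, 1, 1] ![1, 1, 1, m]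
    (by intro i; fin_cases i <;> simp [hm0]) (by simp [Fin.prod_univ_four])
  have h1 : (∏ i : Fin 4, (![1, 1, 1, m] : Fin 4 → ℕ) i ^ (i.val + 1)) = m ^ 4 := by
    simp [Fin.prod_univ_four]
  have h2 : (∏ i : Fin 4, (![1, 1, 1, 1] : Fin 4 → ℕ) i * (![1, 1, 1, 1] : Fin 4 → ℕ) i *
      (![1, 1, 1, m] : Fin 4 → ℕ) i) = m := by
    simp [Fin.prod_univ_four]
  rw [h1, h2, Summit.ABC.ABC.Theorems.UniformSadicGivesTowerFour.bracket_empty hm0.ne', show (1 : ℝ) + 1 = 2 by norm_num,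
    Real.rpow_two] at key
  push_cast at key
  have hm1 : (1 : ℝ) ≤ m := by exact_mod_cast hm0
  have hmC : C * (m : ℝ) ^ 2 < (m : ℝ) ^ 4 := by
    have h3 : (0 : ℝ) ≤ (m : ℝ) ^ 3 := by positivity
    calc C * (m : ℝ) ^ 2 < m * (m : ℝ) ^ 2 := by gcongr
      _ = (m : ℝ) ^ 3 * 1 := by ring
      _ ≤ (m : ℝ) ^ 3 * m := mul_le_mul_of_nonneg_left hm1 h3
      _ = (m : ℝ) ^ 4 := by ring
  linarith

/-- If `S` consists of primes, the bracket is at least `1`. [folklore] -/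
theorem one_le_bracket (M : ℕ) (S : Finset ℕ) (hS : ∀ p ∈ S, Nat.Prime p) :
    (1 : ℝ) ≤ (((∏ p ∈ S, p) * ∏ p ∈ M.primeFactors \ S, p ^ M.factorization p : ℕ) : ℝ) := by
  exact_mod_cast AbcGivesUniformSadic.sadic_pos M S hS

/-- **Positivity is NOT load-bearing.** The crux with the positivity hypothesis deleted is equivalent
to the crux: if some coordinate vanishes then `a = 0` or `b = 0` or `c = 0`, and coprimality with the
equation forces `c ≤ 1`, while the bracket of `M = 0` is `∏_{p∈S} p ≥ 1`; so the constant `max C 2`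
serves the degenerate points.  (Contrast `TowerFourSubLiouville`, where `Π = 0` makes positivity
load-bearing: there the right-hand side is `C·0^{A+ε} = 0`.) -/
theorem uniformSadicTowerFour_iff_without_pos :
    (∀ K : ℕ, ∀ ε : ℝ, 0 < ε → ∃ C : ℝ, 0 < C ∧ ∀ S : Finset ℕ, S.card ≤ K → (∀ p ∈ S, Nat.Prime p) →
      ∀ x y z : Fin 4 → ℕ,
      (∏ i, x i ^ (i.val + 1)) + (∏ i, y i ^ (i.val + 1)) = ∏ i, z i ^ (i.val + 1) →
      Nat.Coprime (∏ i, x i ^ (i.val + 1)) (∏ i, y i ^ (i.val + 1)) →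
      ((∏ i, z i ^ (i.val + 1) : ℕ) : ℝ) < C * (((∏ p ∈ S, p) *
        ∏ p ∈ (∏ i, x i * y i * z i).primeFactors \ S, p ^ (∏ i, x i * y i * z i).factorization p : ℕ) :
          ℝ) ^ (1 + ε)) ↔ UniformSadicTowerFour := by
  constructor
  · intro h K ε hε
    obtain ⟨C, hC, hK⟩ := h K ε hε
    exact ⟨C, hC, fun S hS hP x y z _ hsum hcop => hK S hS hP x y z hsum hcop⟩
  · intro h K ε hε
    obtain ⟨C, hC, hK⟩ := h K ε hε
    refine ⟨max C 2, lt_max_of_lt_left hC, fun S hS hP x y z hsum hcop => ?_⟩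
    have hB := one_le_bracket (∏ i, x i * y i * z i) S hP
    have hBpow : (1 : ℝ) ≤ (((∏ p ∈ S, p) * ∏ p ∈ (∏ i, x i * y i * z i).primeFactors \ S,
        p ^ (∏ i, x i * y i * z i).factorization p : ℕ) : ℝ) ^ (1 + ε) :=
      Real.one_le_rpow hB (by linarith)
    by_cases hpos : ∀ i, 0 < x i ∧ 0 < y i ∧ 0 < z i
    · calc ((∏ i, z i ^ (i.val + 1) : ℕ) : ℝ) < C * _ ^ (1 + ε) := hK S hS hP x y z hpos hsum hcop
        _ ≤ max C 2 * _ ^ (1 + ε) :=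
          mul_le_mul_of_nonneg_right (le_max_left _ _) (by positivity)
    · have hc1 : (∏ i, z i ^ (i.val + 1)) ≤ 1 := by
        push Not at hpos
        obtain ⟨i, hi⟩ := hpos
        by_cases hx : x i = 0
        · have ha : (∏ i, x i ^ (i.val + 1)) = 0 :=
            Finset.prod_eq_zero (Finset.mem_univ i) (by simp [hx])
          rw [ha] at hcop hsum
          have hb : (∏ i, y i ^ (i.val + 1)) = 1 := Nat.coprime_zero_left _ |>.mp hcop
          omega
        by_cases hy : y i = 0
        · have hb : (∏ i, y i ^ (i.val + 1)) = 0 :=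
            Finset.prod_eq_zero (Finset.mem_univ i) (by simp [hy])
          rw [hb] at hcop hsum
          have ha : (∏ i, x i ^ (i.val + 1)) = 1 := Nat.coprime_zero_right _ |>.mp hcop
          omega
        · have hz : z i = 0 := by
            have := hi (Nat.pos_of_ne_zero hx) (Nat.pos_of_ne_zero hy); omega
          have hc : (∏ i, z i ^ (i.val + 1)) = 0 :=
            Finset.prod_eq_zero (Finset.mem_univ i) (by simp [hz])
          omega
      calc ((∏ i, z i ^ (i.val + 1) : ℕ) : ℝ) ≤ 1 := by exact_mod_cast hc1
        _ < 2 * 1 := by norm_num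
        _ ≤ max C 2 * _ ^ (1 + ε) := mul_le_mul (le_max_right _ _) hBpow zero_le_one (by positivity)

end Summit.ABC.ABC.Theorems.UniformSadicTowerFour.Negative
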